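import Summits.BirchSwinnertonDyer.BirchSwinnertonDyer.Theses.LeadingTerm
import Literature.NumberTheory.EllipticCurves.CongruentNumberOne
import Literature.NumberTheory.EllipticCurves.BSDAnalyticRankTunnellCMProofs
import Literature.NumberTheory.EllipticCurves.CongruentNumberCurveSupersingular
import Literature.NumberTheory.EllipticCurves.ComplexMultiplicationLocalFactorsAux
import Literature.NumberTheory.EllipticCurves.ModularSymbolsProofs
import Literature.NumberTheory.EllipticCurves.ModularSymbolsNormalizedSymbolProofs

/-!
# Negative lemma for crux `LeadingTerm.Consistency` (stmt-BirchSwinnertonDyer-16217):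
# the hypothesis `IsNewformOf W f` is load-bearing

Refuter / crux-disprover file (Negative lane, supports stmt-BirchSwinnertonDyer-16217; it does NOT
refute the crux). `Consistency` quantifies
`∀ W … p … D, D.IsCanonical → ∀ ⦃N⦄ [NeZero N] (f : CuspForm (Γ₀(N)) 2), IsNewformOf W f → 0 < Reg_∞(W)
∧ 0 < Ω⁺_f ∧ ∃ q, …`. We record, sorry-free, that the statement with the modularity hypothesis
`IsNewformOf W f` DROPPED (`ConsistencyWithoutNewform` in the crux work-file) is FALSE: at the curve
`E₁ : y² = x³ − x` (Cremona 32a2, `congruentNumberCurve 1`, globally minimal, good ORDINARY at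
`p = 5` since `#Ẽ₁(𝔽₅) = 8`, `a₅ = −2`) every rational point is `2`-torsion (Fermat; tree theorem
`two_nsmul_point_congruentNumberCurve_one`), so NO point is admissible and EVERY `p`-adic height
datum — in particular the zero datum — satisfies `PAdicHeightData.IsCanonical` (the predicate only
constrains admissible, hence non-torsion, points); and the zero cusp form `0 ∈ S₂(Γ₀(1))` has
period lattice `⊥`, hence `plusPeriod 0 = 0` (junk branch of the `dite`), violating the conjunct
`0 < Ω⁺_f`. Consequences for provers of `Consistency` (see the crux work-file
`Cruxes/Consistency/Disproof.lean`): (i) the well-definedness conjunct `0 < Ω⁺_f` is exactly where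
`IsNewformOf` (through `IsNewform0 f`, Eichler–Shimura: `Λ_f` is a rank-2 lattice) must enter —
it is the tree theorem `IsNewform0.plusPeriod_pos_holds`, not a triviality of the `dite`;
(ii) in Mordell–Weil rank `0` the hypothesis `D.IsCanonical` is VACUOUS (every datum is canonical),
which is harmless only because `padicRegulator D` is then the empty determinant `1`.
[folklore]
-/

noncomputable section

open scoped Classical
open WeierstrassCurve CongruenceSubgroup
open Literature.NumberTheory.EllipticCurves Literature.NumberTheory.EllipticCurves.ModularForms

namespace Summit.BirchSwinnertonDyer.BirchSwinnertonDyer.Theorems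

/-- The zero cusp form has all cusp-to-cusp periods `{∞, γ∞}_0 = 0` (homogeneity of the modular
symbol in the form, `cuspSymbol_smul`, at the scalar `0`). [folklore] -/
theorem ConsistencyNegative.cuspSymbol_zero (N : ℕ) (γ : Gamma0 N) :
    cuspSymbol (0 : CuspForm (Gamma0 N) 2) γ = 0 := by
  have h := cuspSymbol_smul (0 : ℂ) (0 : CuspForm (Gamma0 N) 2) γ
  rwa [zero_smul, zero_mul] at h

/-- The period lattice `Λ_0` of the zero cusp form is `⊥`. [folklore] -/
theorem ConsistencyNegative.periodLattice_zero (N : ℕ) :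
    periodLattice (0 : CuspForm (Gamma0 N) 2) = ⊥ := by
  rw [periodLattice, AddSubgroup.closure_eq_bot_iff]
  rintro _ ⟨γ, rfl⟩
  exact ConsistencyNegative.cuspSymbol_zero N γ

/-- `re Λ_0 = ⊥` for the zero cusp form. [folklore] -/
theorem ConsistencyNegative.realPeriods_zero (N : ℕ) :
    realPeriods (0 : CuspForm (Gamma0 N) 2) = ⊥ := by
  rw [realPeriods, ConsistencyNegative.periodLattice_zero, AddSubgroup.map_bot]

/-- **`Ω⁺_0 = 0`**: the real period of the zero cusp form is the junk value `0` of `plusPeriod`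
(`re Λ_0 = ⊥` is not infinite cyclic; dichotomy `plusPeriod_eq_zero_or`). [folklore] -/
theorem ConsistencyNegative.plusPeriod_zero (N : ℕ) : plusPeriod (0 : CuspForm (Gamma0 N) 2) = 0 := by
  rcases plusPeriod_eq_zero_or (0 : CuspForm (Gamma0 N) 2) with h | ⟨hpos, heq⟩
  · exact h
  · exfalso
    rw [ConsistencyNegative.realPeriods_zero] at heq
    have hmem : plusPeriod (0 : CuspForm (Gamma0 N) 2) / 2 ∈ (⊥ : AddSubgroup ℝ) := by
      rw [heq]; exact AddSubgroup.mem_zmultiples _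
    rw [AddSubgroup.mem_bot] at hmem
    linarith

/-- `#Ẽ₁(𝔽₅) = 8` for `E₁ : y² = x³ − x` (points `O, (0,0), (±1,0), (2,±1), (3,±2)`), counted on
the tree's `ℤ`-model `congruentNumberCurveInt 1` (`numPointsMod`). [folklore] -/
theorem ConsistencyNegative.numPointsMod_congruentNumberCurveInt_one_five :
    Literature.NumberTheory.Automorphic.numPointsMod (congruentNumberCurveInt 1) 5 = 8 := by
  unfold Literature.NumberTheory.Automorphic.numPointsMod
  rw [map_congruentNumberCurveInt, natCard_point_eq_one_add_card _ (by decide)]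
  decide

/-- `5 ∤ a₅(E₁) = −2`: `E₁` is ordinary at `5` (as at every `p ≡ 1 mod 4`). [folklore] -/
theorem ConsistencyNegative.not_five_dvd_frobeniusTrace_congruentNumberCurve_one
    [(congruentNumberCurve 1).IsGloballyMinimal] :
    ¬ (5 : ℤ) ∣ (congruentNumberCurve 1).frobeniusTrace 5 := by
  rw [frobeniusTrace_congruentNumberCurve 1 5, Literature.NumberTheory.Automorphic.frobeniusTrace,
    ConsistencyNegative.numPointsMod_congruentNumberCurveInt_one_five]
  decide

/-- `E₁ : y² = x³ − x` is good ordinary at `p = 5` (`IsOrdinaryAt`: good reduction as `5 ∤ 2·1`,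
tree theorem `hasGoodReductionAtPrime_congruentNumberCurve`, and `5 ∤ a₅`). [folklore] -/
theorem ConsistencyNegative.isOrdinaryAt_congruentNumberCurve_one_five [Fact (Nat.Prime 5)]
    [(congruentNumberCurve 1).IsGloballyMinimal] : IsOrdinaryAt (congruentNumberCurve 1) 5 :=
  ⟨hasGoodReductionAtPrime_congruentNumberCurve (by norm_num),
    ConsistencyNegative.not_five_dvd_frobeniusTrace_congruentNumberCurve_one⟩

/-- **On `E₁` every `p`-adic height datum is canonical** (for every prime `p`): `IsCanonical` only
constrains ADMISSIBLE points, which are non-torsion by definition, and `E₁(ℚ) = E₁[2]`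
(`two_nsmul_point_congruentNumberCurve_one`, Fermat's descent). [folklore] -/
theorem ConsistencyNegative.isCanonical_congruentNumberCurve_one (p : ℕ) [Fact p.Prime]
    (D : PAdicHeightData (congruentNumberCurve 1) p) : D.IsCanonical := by
  intro P hP
  exact absurd ((isOfFinAddOrder_iff_nsmul_eq_zero).mpr ⟨2, two_pos,
    two_nsmul_point_congruentNumberCurve_one P⟩) hP.1

/-- **`Consistency` is false without `IsNewformOf W f`** (load-bearing hypothesis; negative lemma
supporting stmt-BirchSwinnertonDyer-16217, not a refutation of it). The negated statement is the
body of `LeadingTerm.Consistency` verbatim with the single hypothesis `IsNewformOf W f` deleted (it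
is `ConsistencyWithoutNewform` of the crux work-file `Cruxes/Consistency/Disproof.lean`). Witness: `W = E₁ = [0,0,0,−1,0]`
(globally minimal, elliptic), `p = 5` (good ordinary), `D =` the zero datum (canonical on `E₁`,
whose rational points are all `2`-torsion), `N = 1`, `f = 0`: then `Ω⁺_f = plusPeriod 0 = 0`
contradicts the conjunct `0 < Ω⁺_f`. [folklore] -/
theorem consistency_false_without_newform :
    ¬ (∀ (W : WeierstrassCurve ℚ) [W.IsElliptic] [W.IsGloballyMinimal] (p : ℕ) [Fact p.Prime], 5 ≤ p → Literature.NumberTheory.EllipticCurves.IsOrdinaryAt W p → ∀ (D : WeierstrassCurve.PAdicHeightData W p), D.IsCanonical → ∀ ⦃N : ℕ⦄ [NeZero N] (f : CuspForm (CongruenceSubgroup.Gamma0 N) 2), 0 < W.regulator ∧ 0 < Literature.NumberTheory.EllipticCurves.ModularForms.plusPeriod f ∧ ∃ q : ℚ, iteratedDeriv W.mordellWeilRank W.entireLFunction 1 = (((W.mordellWeilRank.factorial : ℝ) * (q : ℝ) * Literature.NumberTheory.EllipticCurves.ModularForms.plusPeriod f * W.regulator : ℝ) : ℂ) ∧ PowerSeries.coeff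 W.mordellWeilRank (Literature.NumberTheory.EllipticCurves.padicLFunction f (Literature.NumberTheory.EllipticCurves.unitRoot W p : ℚ_[p])) * Literature.NumberTheory.EllipticCurves.padicLog p (Literature.NumberTheory.EllipticCurves.cyclotomicGenerator p) ^ W.mordellWeilRank = (q : ℚ_[p]) * (1 - (Literature.NumberTheory.EllipticCurves.unitRoot W p : ℚ_[p])⁻¹) ^ 2 * WeierstrassCurve.padicRegulator D) := by
  intro h
  haveI : Fact (Nat.Prime 5) := ⟨by norm_num⟩
  haveI : (congruentNumberCurve 1).IsElliptic := isElliptic_congruentNumberCurve one_ne_zero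
  haveI : (congruentNumberCurve 1).IsGloballyMinimal :=
    isGloballyMinimal_congruentNumberCurve squarefree_one
  obtain ⟨-, hΩ, -⟩ := h (congruentNumberCurve 1) 5 le_rfl
    ConsistencyNegative.isOrdinaryAt_congruentNumberCurve_one_five
    ⟨0, fun _ _ => rfl, fun _ _ _ => rfl⟩
    (ConsistencyNegative.isCanonical_congruentNumberCurve_one 5 _) (N := 1)
    (0 : CuspForm (CongruenceSubgroup.Gamma0 1) 2)
  rw [ConsistencyNegative.plusPeriod_zero] at hΩ
  exact lt_irrefl _ hΩ

end Summit.BirchSwinnertonDyer.BirchSwinnertonDyer.Theorems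

end
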